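import Summits.QuantumFields.YangMills.Theorems.SpecificationCompactnessGibbsLimitUniquenessDoeblin
import Summits.QuantumFields.YangMills.Theorems.SpecificationCompactnessScheffeUnbounded

/-!
# Route `SpecificationCompactness`, LINE 14 «tail_trivial_kernel» — UNIQUENESS OF DLR DENSITIES for an a.e.-positive
# fibre-normalised single-site specification on a finite product (support for `TailTrivialUniqueness`, stmt-QuantumFields-22690)

Setting: `X = ι → G` (finitely many sites), `Π = ⊗_ι η` (`η` a probability measure), `m_e = σ(coordinates ≠ e)`, and single-site
profiles `q_e ≥ 0`, measurable, `q_e > 0` Π-a.e., fibre-normalised `P[q_e | m_e] = 1` a.e.  A density `g ∈ L¹(Π)` is DLR when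
`g = P[g | m_e]·q_e` a.e. for every `e` (equivalently: `g·Π` is invariant under every single-site resampling kernel).

MAIN RESULT `dlr_density_unique`: two non-negative DLR densities with the same mass coincide a.e.  PROOF (no Doeblin, no continuity,
no floor): (1) `T_e f := P[f|m_e]·q_e` is positive, linear and MASS-PRESERVING on `L¹` (`∫ T_e f = ∫ f`, from `(q_e·Π).trim m_e =
Π.trim m_e` — tree `integrable_condExp_mul_and_integral_eq`), so the minimum of two DLR densities is again DLR (`T_e min ≤ min`, equal
masses), hence so are `(g − g′)₊` and `(g′ − g)₊`; (2) TAIL TRIVIALITY: a bounded measurable `f` with `P[f|m_e] = f` a.e. for EVERY `e`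
is a.e. constant — `P[·|m_e]` is the fibre integral (tree `condExp_pi_ae_eq_integral_update`), so `f` equals a.e. its full pure
resampling sweep, which is a constant; (3) for a non-negative DLR `v`, the set `{v > 0}` is a.e. `m_e`-measurable for every `e`
(`= {P[v|m_e] > 0}` a.e., as `q_e > 0` a.e.), hence trivial: a non-zero non-negative DLR density is `> 0` a.e.; (4) `(g − g′)₊` and
`(g′ − g)₊` have disjoint supports and equal masses, so both vanish.

HONEST FRAMING: measure theory only [folklore] (Georgii, *Gibbs Measures and Phase Transitions*, Ch. 1–2 pattern, finite volume);
nothing about the YM mass gap, no rung and no summit statement is proved here.  No definitions, no named facts.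
-/

noncomputable section

namespace Summit.QuantumFields.YangMills.Theorems.SpecificationCompactnessDLR

open MeasureTheory Filter Topology Function Set
open Summit.QuantumFields.YangMills.Theorems.SpecificationCompactnessKernel
open Summit.QuantumFields.YangMills.Theorems.SpecificationCompactnessDensityMerging
open Summit.QuantumFields.YangMills.Theorems.GibbsLimitUniqueness

/-! ## §1 General sub-σ-algebra: the operator `f ↦ π[f|m]·q` and minima of DLR densities -/

section General

variable {X : Type*} {m m0 : MeasurableSpace X} {π : Measure X} [IsFiniteMeasure π]

/-- **THE MINIMUM OF TWO DLR DENSITIES IS DLR.**  If `g = π[g|m]·q` and `g' = π[g'|m]·q` a.e. (`q ≥ 0` measurable,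
`π[q|m] = 1` a.e.), then `min g g' = π[min g g'|m]·q` a.e.: `π[min|m]·q ≤ min(π[g|m]·q, π[g'|m]·q) = min(g,g')` a.e. by
monotonicity, and both sides have the same integral. [folklore] -/
theorem min_dlr (hm : m ≤ m0) {q : X → ℝ} (hq : Measurable q) (hq0 : ∀ x, 0 ≤ q x) (hq1 : ∀ᵐ x ∂π, π[q|m] x = 1)
    (hqi : Integrable q π) {g g' : X → ℝ} (hgi : Integrable g π) (hgi' : Integrable g' π)
    (hg : g =ᵐ[π] fun x => π[g|m] x * q x) (hg' : g' =ᵐ[π] fun x => π[g'|m] x * q x) :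
    (fun x => min (g x) (g' x)) =ᵐ[π] fun x => π[fun y => min (g y) (g' y)|m] x * q x := by
  set μ : X → ℝ := fun x => min (g x) (g' x) with hμ
  have hμi : Integrable μ π := hgi.inf hgi'
  obtain ⟨hTi, hTint⟩ := integrable_condExp_mul_and_integral_eq hm hq hq0 hq1 hqi
  -- `T μ ≤ μ` a.e.
  have h1 : (π[μ|m]) ≤ᵐ[π] π[g|m] := condExp_mono hμi hgi (Eventually.of_forall fun x => min_le_left _ _)
  have h2 : (π[μ|m]) ≤ᵐ[π] π[g'|m] := condExp_mono hμi hgi' (Eventually.of_forall fun x => min_le_right _ _)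
  have hle : (fun x => π[μ|m] x * q x) ≤ᵐ[π] μ := by
    filter_upwards [h1, h2, hg, hg'] with x hx1 hx2 hxg hxg'
    refine le_min ?_ ?_
    · rw [hxg]; exact mul_le_mul_of_nonneg_right hx1 (hq0 x)
    · rw [hxg']; exact mul_le_mul_of_nonneg_right hx2 (hq0 x)
  -- equal integrals force a.e. equality
  have hdiff0 : (fun x => μ x - π[μ|m] x * q x) =ᵐ[π] 0 := by
    have hnn : 0 ≤ᵐ[π] fun x => μ x - π[μ|m] x * q x := hle.mono fun x hx => sub_nonneg.mpr hx
    have hint : ∫ x, (μ x - π[μ|m] x * q x) ∂π = 0 := by rw [integral_sub hμi hTi, hTint, sub_self]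
    exact (integral_eq_zero_iff_of_nonneg_ae hnn (hμi.sub hTi)).mp hint
  filter_upwards [hdiff0] with x hx
  have : μ x - π[μ|m] x * q x = 0 := hx
  linarith

omit [IsFiniteMeasure π] in
/-- DLR passes to differences: if `g`, `h` are DLR then so is `g − h`. [folklore] -/
theorem sub_dlr {q : X → ℝ} {g h : X → ℝ} (hgi : Integrable g π) (hhi : Integrable h π)
    (hg : g =ᵐ[π] fun x => π[g|m] x * q x) (hh : h =ᵐ[π] fun x => π[h|m] x * q x) :
    (fun x => g x - h x) =ᵐ[π] fun x => π[fun y => g y - h y|m] x * q x := by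
  have hsub : π[fun y => g y - h y|m] =ᵐ[π] fun x => π[g|m] x - π[h|m] x := by
    have := condExp_sub hgi hhi m
    filter_upwards [this] with x hx
    exact hx
  filter_upwards [hsub, hg, hh] with x hx hxg hxh
  rw [hx, sub_mul, ← hxg, ← hxh]

end General

/-! ## §2 Finite products: pure resampling sweeps and tail triviality -/

section Product

variable {ι : Type*} [Fintype ι] [DecidableEq ι] {G : Type*} [MeasurableSpace G] (η : Measure G) [IsProbabilityMeasure η]

omit [Fintype ι] in
/-- A bounded measurable `f` has bounded, strongly measurable PURE RESAMPLING SWEEPS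
`P_l f = (e₁ :: …) ↦ ∫ (P_{…} f)(V[e₁ ↦ w]) dη(w)`. [folklore] -/
theorem sweep_measurable_bdd {f : (ι → G) → ℝ} (hf : Measurable f) {C : ℝ} (hC : ∀ V, |f V| ≤ C) :
    ∀ l : List ι, StronglyMeasurable (l.foldr (fun e g => fun V : ι → G => ∫ w, g (Function.update V e w) ∂η) f) ∧
      ∀ V, |l.foldr (fun e g => fun V : ι → G => ∫ w, g (Function.update V e w) ∂η) f V| ≤ C
  | [] => ⟨by simpa using hf.stronglyMeasurable, by simpa using hC⟩
  | e :: l => by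
    obtain ⟨hm, hb⟩ := sweep_measurable_bdd hf hC l
    set g := l.foldr (fun e g => fun V : ι → G => ∫ w, g (Function.update V e w) ∂η) f with hg
    rw [List.foldr_cons]
    refine ⟨?_, fun V => ?_⟩
    · have h2 : StronglyMeasurable (uncurry fun (V : ι → G) (w : G) => g (Function.update V e w)) :=
        (hm.measurable.comp measurable_update').stronglyMeasurable
      exact h2.integral_prod_right
    · have := norm_integral_le_of_norm_le_const (μ := η) (f := fun w => g (Function.update V e w)) (C := C)
        (Eventually.of_forall fun w => by rw [Real.norm_eq_abs]; exact hb _)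
      rw [Real.norm_eq_abs, probReal_univ, mul_one] at this
      exact this

omit [Fintype ι] [IsProbabilityMeasure η] in
/-- LOCALITY: the pure sweep `P_l f (V)` depends only on the coordinates of `V` off `l`. [folklore] -/
theorem sweep_eq_of_eqOn_compl {f : (ι → G) → ℝ} :
    ∀ (l : List ι) (V V' : ι → G), (∀ i, i ∉ l → V i = V' i) →
      l.foldr (fun e g => fun V : ι → G => ∫ w, g (Function.update V e w) ∂η) f V
        = l.foldr (fun e g => fun V : ι → G => ∫ w, g (Function.update V e w) ∂η) f V'
  | [], V, V', h => by
    have hVV' : V = V' := funext fun i => h i (by simp)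
    simp [hVV']
  | e :: l, V, V', h => by
    rw [List.foldr_cons]
    refine integral_congr_ae (Eventually.of_forall fun w => ?_)
    have hupd : ∀ i, i ∉ l → Function.update V e w i = Function.update V' e w i := by
      intro i hi
      by_cases hie : i = e
      · subst hie; simp
      · rw [Function.update_of_ne hie, Function.update_of_ne hie]
        exact h i (by simp [hie, hi])
    exact sweep_eq_of_eqOn_compl l _ _ hupd

/-- **TAIL TRIVIALITY ON A FINITE PRODUCT.**  A bounded measurable `f` on `ι → G` with `P[f | σ(coords ≠ e)] = f` a.e. for EVERY
coordinate `e` is a.e. CONSTANT (equal to its full pure resampling sweep, a constant by locality). [folklore] -/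
theorem ae_eq_const_of_forall_condExp_eq {f : (ι → G) → ℝ} (hf : Measurable f) {C : ℝ} (hC : ∀ V, |f V| ≤ C)
    (hinv : ∀ e : ι, (Measure.pi fun _ : ι => η)[f | MeasurableSpace.comap (fun (W : ι → G) (b : {b // b ≠ e}) => W b.1)
        MeasurableSpace.pi] =ᵐ[Measure.pi fun _ : ι => η] f) :
    ∃ c : ℝ, f =ᵐ[Measure.pi fun _ : ι => η] fun _ => c := by
  -- `f = P_l f` a.e. for every list of coordinates
  have key : ∀ l : List ι,
      f =ᵐ[Measure.pi fun _ : ι => η] l.foldr (fun e g => fun V : ι → G => ∫ w, g (Function.update V e w) ∂η) f := by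
    intro l
    induction l with
    | nil => simp
    | cons e l ih =>
      obtain ⟨hmeas, hbdd⟩ := sweep_measurable_bdd η hf hC l
      set g := l.foldr (fun e g => fun V : ι → G => ∫ w, g (Function.update V e w) ∂η) f with hg
      have hgi : Integrable g (Measure.pi fun _ : ι => η) :=
        Integrable.of_bound hmeas.aestronglyMeasurable C (Eventually.of_forall fun V => by
          rw [Real.norm_eq_abs]; exact hbdd V)
      have h1 := (hinv e).symm
      have h2 : (Measure.pi fun _ : ι => η)[f | MeasurableSpace.comap (fun (W : ι → G) (b : {b // b ≠ e}) => W b.1)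
          MeasurableSpace.pi] =ᵐ[Measure.pi fun _ : ι => η]
          (Measure.pi fun _ : ι => η)[g | MeasurableSpace.comap (fun (W : ι → G) (b : {b // b ≠ e}) => W b.1)
          MeasurableSpace.pi] := condExp_congr_ae ih
      have h3 := condExp_pi_ae_eq_integral_update η e hmeas hgi
      rw [List.foldr_cons]
      exact h1.trans (h2.trans h3)
  classical
  obtain ⟨V₀⟩ : Nonempty (ι → G) := by
    have : (Measure.pi fun _ : ι => η) ≠ 0 := IsProbabilityMeasure.ne_zero _
    by_contra h
    rw [not_nonempty_iff] at h
    exact this (Measure.eq_zero_of_isEmpty _)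
  set l₀ : List ι := Finset.univ.toList with hl₀
  refine ⟨l₀.foldr (fun e g => fun V : ι → G => ∫ w, g (Function.update V e w) ∂η) f V₀, ?_⟩
  filter_upwards [key l₀] with V hV
  rw [hV]
  exact sweep_eq_of_eqOn_compl η l₀ V V₀ fun i hi => absurd (by simp [hl₀]) hi

/-! ## §3 A non-zero non-negative DLR density is positive a.e. -/

/-- For a non-negative DLR density `v` (`v = P[v|m_e]·q_e` a.e. for every `e`, `q_e > 0` a.e.) that is not a.e. zero:
`v > 0` a.e.  (The set `{v > 0}` is a.e. `m_e`-measurable for every `e`, hence trivial by tail triviality.) [folklore] -/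
theorem ae_pos_of_dlr {q : ι → (ι → G) → ℝ}
    (hqpos : ∀ e, ∀ᵐ V ∂(Measure.pi fun _ : ι => η), 0 < q e V)
    {v : (ι → G) → ℝ} (hvm : Measurable v)
    (hv0 : 0 ≤ᵐ[Measure.pi fun _ : ι => η] v)
    (hdlr : ∀ e : ι, v =ᵐ[Measure.pi fun _ : ι => η] fun V =>
      ((Measure.pi fun _ : ι => η)[v | MeasurableSpace.comap (fun (W : ι → G) (b : {b // b ≠ e}) => W b.1)
        MeasurableSpace.pi]) V * q e V)
    (hne : ¬ v =ᵐ[Measure.pi fun _ : ι => η] 0) :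
    ∀ᵐ V ∂(Measure.pi fun _ : ι => η), 0 < v V := by
  set P : Measure (ι → G) := Measure.pi fun _ : ι => η with hP
  set S : Set (ι → G) := {V | 0 < v V} with hS
  have hSm : MeasurableSet S := measurableSet_lt measurable_const hvm
  set f : (ι → G) → ℝ := S.indicator (fun _ => (1:ℝ)) with hfdef
  have hfm : Measurable f := measurable_const.indicator hSm
  have hfb : ∀ V, |f V| ≤ 1 := fun V => by
    by_cases h : V ∈ S
    · simp [hfdef, h]
    · simp [hfdef, h]
  -- `f` is invariant under every `P[·|m_e]`
  have hinv : ∀ e : ι, P[f | MeasurableSpace.comap (fun (W : ι → G) (b : {b // b ≠ e}) => W b.1)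
      MeasurableSpace.pi] =ᵐ[P] f := by
    intro e
    have hm : MeasurableSpace.comap (fun (W : ι → G) (b : {b // b ≠ e}) => W b.1) MeasurableSpace.pi ≤
        (inferInstance : MeasurableSpace (ι → G)) :=
      Measurable.comap_le (measurable_pi_lambda _ fun b => measurable_pi_apply b.1)
    set c := P[v | MeasurableSpace.comap (fun (W : ι → G) (b : {b // b ≠ e}) => W b.1) MeasurableSpace.pi] with hc
    have hcm : StronglyMeasurable[MeasurableSpace.comap (fun (W : ι → G) (b : {b // b ≠ e}) => W b.1)
        MeasurableSpace.pi] c := stronglyMeasurable_condExp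
    have hc0 : 0 ≤ᵐ[P] c := condExp_nonneg hv0
    set A : Set (ι → G) := {V | 0 < c V} with hA
    have hAm : MeasurableSet[MeasurableSpace.comap (fun (W : ι → G) (b : {b // b ≠ e}) => W b.1)
        MeasurableSpace.pi] A := hcm.measurable measurableSet_Ioi
    -- `1_S = 1_A` a.e.
    have hSA : f =ᵐ[P] A.indicator (fun _ => (1:ℝ)) := by
      filter_upwards [hdlr e, hqpos e, hc0] with V hV hqV hcV
      have hcV' : 0 ≤ c V := by simpa using hcV
      have hvV : v V = c V * q e V := by rw [hV]
      have hiff : V ∈ S ↔ V ∈ A := by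
        show 0 < v V ↔ 0 < c V
        rw [hvV]
        exact mul_pos_iff_of_pos_right hqV
      by_cases hVS : V ∈ S
      · rw [hfdef, Set.indicator_of_mem hVS, Set.indicator_of_mem (hiff.mp hVS)]
      · rw [hfdef, Set.indicator_of_notMem hVS, Set.indicator_of_notMem (fun h => hVS (hiff.mpr h))]
    have hAi : Integrable (A.indicator fun _ => (1:ℝ)) P := (integrable_const (1:ℝ)).indicator (hm _ hAm)
    have hAsm : StronglyMeasurable[MeasurableSpace.comap (fun (W : ι → G) (b : {b // b ≠ e}) => W b.1)
        MeasurableSpace.pi] (A.indicator fun _ => (1:ℝ)) :=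
      stronglyMeasurable_const.indicator hAm
    calc P[f | MeasurableSpace.comap (fun (W : ι → G) (b : {b // b ≠ e}) => W b.1) MeasurableSpace.pi]
        =ᵐ[P] P[A.indicator fun _ => (1:ℝ) | MeasurableSpace.comap (fun (W : ι → G) (b : {b // b ≠ e}) => W b.1)
          MeasurableSpace.pi] := condExp_congr_ae hSA
      _ = A.indicator fun _ => (1:ℝ) := condExp_of_stronglyMeasurable hm hAsm hAi
      _ =ᵐ[P] f := hSA.symm
  obtain ⟨c₀, hc₀⟩ := ae_eq_const_of_forall_condExp_eq η hfm hfb hinv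
  -- `Π S > 0`
  have hSpos : 0 < P S := by
    by_contra h
    have hS0 : P S = 0 := nonpos_iff_eq_zero.mp (not_lt.mp h)
    apply hne
    have h1 : ∀ᵐ V ∂P, V ∉ S := measure_eq_zero_iff_ae_notMem.mp hS0
    filter_upwards [h1, hv0] with V hV hV0
    have : ¬ 0 < v V := hV
    exact le_antisymm (not_lt.mp this) hV0
  -- the constant is not `0`, hence `S` has full measure
  have hc₀ne : c₀ ≠ 0 := by
    intro h0
    rw [h0] at hc₀
    have : ∀ᵐ V ∂P, V ∉ S := by
      filter_upwards [hc₀] with V hV hVS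
      rw [hfdef, Set.indicator_of_mem hVS] at hV
      exact one_ne_zero hV
    exact (lt_irrefl 0) (lt_of_lt_of_eq hSpos (measure_eq_zero_iff_ae_notMem.mpr this))
  filter_upwards [hc₀] with V hV
  by_contra hVS
  rw [hfdef, Set.indicator_of_notMem (show V ∉ S from hVS)] at hV
  exact hc₀ne hV.symm

/-! ## §4 Uniqueness of DLR densities -/

/-- **UNIQUENESS OF DLR DENSITIES.**  On the finite product `ι → G` with product probability measure `Π = ⊗ η` and single-site
profiles `q_e ≥ 0` (measurable, `> 0` a.e., `P[q_e | σ(coords ≠ e)] = 1` a.e.): two non-negative integrable `g, g'` with the same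
integral and `g = P[g|m_e]·q_e`, `g' = P[g'|m_e]·q_e` a.e. for every `e` coincide a.e. [folklore] -/
theorem dlr_density_unique {q : ι → (ι → G) → ℝ} (hqm : ∀ e, Measurable (q e)) (hq0 : ∀ e V, 0 ≤ q e V)
    (hqpos : ∀ e, ∀ᵐ V ∂(Measure.pi fun _ : ι => η), 0 < q e V)
    (hq1 : ∀ e, ∀ᵐ V ∂(Measure.pi fun _ : ι => η),
      ((Measure.pi fun _ : ι => η)[q e | MeasurableSpace.comap (fun (W : ι → G) (b : {b // b ≠ e}) => W b.1)
        MeasurableSpace.pi]) V = 1)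
    {g g' : (ι → G) → ℝ} (hgm : Measurable g) (hgm' : Measurable g')
    (hgi : Integrable g (Measure.pi fun _ : ι => η)) (hgi' : Integrable g' (Measure.pi fun _ : ι => η))
    (hmass : ∫ V, g V ∂(Measure.pi fun _ : ι => η) = ∫ V, g' V ∂(Measure.pi fun _ : ι => η))
    (hdlr : ∀ e : ι, g =ᵐ[Measure.pi fun _ : ι => η] fun V =>
      ((Measure.pi fun _ : ι => η)[g | MeasurableSpace.comap (fun (W : ι → G) (b : {b // b ≠ e}) => W b.1)
        MeasurableSpace.pi]) V * q e V)
    (hdlr' : ∀ e : ι, g' =ᵐ[Measure.pi fun _ : ι => η] fun V =>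
      ((Measure.pi fun _ : ι => η)[g' | MeasurableSpace.comap (fun (W : ι → G) (b : {b // b ≠ e}) => W b.1)
        MeasurableSpace.pi]) V * q e V) :
    g =ᵐ[Measure.pi fun _ : ι => η] g' := by
  set P : Measure (ι → G) := Measure.pi fun _ : ι => η with hP
  have hm : ∀ e : ι, MeasurableSpace.comap (fun (W : ι → G) (b : {b // b ≠ e}) => W b.1) MeasurableSpace.pi ≤
      (inferInstance : MeasurableSpace (ι → G)) :=
    fun e => Measurable.comap_le (measurable_pi_lambda _ fun b => measurable_pi_apply b.1)
  have hqi : ∀ e, Integrable (q e) P := fun e => integrable_of_condExp_ae_eq_one (hq1 e)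
  -- the minimum and the two positive parts
  set μ : (ι → G) → ℝ := fun V => min (g V) (g' V) with hμ
  have hμm : Measurable μ := hgm.min hgm'
  have hμi : Integrable μ P := hgi.inf hgi'
  have hμdlr : ∀ e : ι, μ =ᵐ[P] fun V =>
      (P[μ | MeasurableSpace.comap (fun (W : ι → G) (b : {b // b ≠ e}) => W b.1) MeasurableSpace.pi]) V * q e V :=
    fun e => min_dlr (hm e) (hqm e) (hq0 e) (hq1 e) (hqi e) hgi hgi' (hdlr e) (hdlr' e)
  set d : (ι → G) → ℝ := fun V => g V - μ V with hd
  set d' : (ι → G) → ℝ := fun V => g' V - μ V with hd'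
  have hdm : Measurable d := hgm.sub hμm
  have hdm' : Measurable d' := hgm'.sub hμm
  have hdi : Integrable d P := hgi.sub hμi
  have hdi' : Integrable d' P := hgi'.sub hμi
  have hd0 : ∀ V, 0 ≤ d V := fun V => sub_nonneg.mpr (min_le_left _ _)
  have hd0' : ∀ V, 0 ≤ d' V := fun V => sub_nonneg.mpr (min_le_right _ _)
  have hdd' : ∀ V, d V = 0 ∨ d' V = 0 := fun V => by
    rcases le_total (g V) (g' V) with h | h
    · left; simp [hd, hμ, min_eq_left h]
    · right; simp [hd', hμ, min_eq_right h]
  have hddlr : ∀ e : ι, d =ᵐ[P] fun V =>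
      (P[d | MeasurableSpace.comap (fun (W : ι → G) (b : {b // b ≠ e}) => W b.1) MeasurableSpace.pi]) V * q e V :=
    fun e => sub_dlr hgi hμi (hdlr e) (hμdlr e)
  have hddlr' : ∀ e : ι, d' =ᵐ[P] fun V =>
      (P[d' | MeasurableSpace.comap (fun (W : ι → G) (b : {b // b ≠ e}) => W b.1) MeasurableSpace.pi]) V * q e V :=
    fun e => sub_dlr hgi' hμi (hdlr' e) (hμdlr e)
  have hmass' : ∫ V, d V ∂P = ∫ V, d' V ∂P := by
    simp only [hd, hd']
    rw [integral_sub hgi hμi, integral_sub hgi' hμi, hmass]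
  -- case analysis: is `d` a.e. zero?
  by_cases hdz : d =ᵐ[P] 0
  · -- then `g ≤ g'` a.e., and `d'` has integral `0`, so `g' ≤ g` a.e.
    have hint0 : ∫ V, d' V ∂P = 0 := by
      rw [← hmass', integral_congr_ae hdz]; simp
    have hdz' : d' =ᵐ[P] 0 := (integral_eq_zero_iff_of_nonneg_ae (Eventually.of_forall hd0') hdi').mp hint0
    filter_upwards [hdz, hdz'] with V hV hV'
    have h1 : g V - μ V = 0 := hV
    have h2 : g' V - μ V = 0 := hV'
    linarith
  · -- otherwise `d > 0` a.e. and `d' > 0` a.e.: impossible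
    exfalso
    have hdpos : ∀ᵐ V ∂P, 0 < d V := ae_pos_of_dlr η hqpos hdm (Eventually.of_forall hd0) hddlr hdz
    have hintpos : 0 < ∫ V, d V ∂P := by
      refine lt_of_le_of_ne (integral_nonneg hd0) (fun h0 => hdz ?_)
      exact (integral_eq_zero_iff_of_nonneg_ae (Eventually.of_forall hd0) hdi).mp h0.symm
    have hdz' : ¬ d' =ᵐ[P] 0 := by
      intro h
      have : ∫ V, d' V ∂P = 0 := by rw [integral_congr_ae h]; simp
      linarith [hmass']
    have hdpos' : ∀ᵐ V ∂P, 0 < d' V := ae_pos_of_dlr η hqpos hdm' (Eventually.of_forall hd0') hddlr' hdz'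
    obtain ⟨V, hV, hV'⟩ := (hdpos.and hdpos').exists
    rcases hdd' V with h | h
    · exact (lt_irrefl 0) (lt_of_lt_of_eq hV h)
    · exact (lt_irrefl 0) (lt_of_lt_of_eq hV' h)

end Product

end Summit.QuantumFields.YangMills.Theorems.SpecificationCompactnessDLR

end
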